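/-
Copyright (c) 2026 the pub-hodgecm-mathlib formalisation cell (harness21).  Prover seat hodgecm-mathlib-K2E4-p14 (g9), Track B ∕ K2-LIT, h413 = `stmt-HodgeConjecture-24833`,
route of record `HCCMUnconditional`, AMENDMENT #3 rung C.1 (C7_τ FILE 1); dealer K2E1-plan (g7) deal (265): the `τ`-twisted `K`-type averaging projector — ★ F1
`K2E1KAverageProjectionU` (τ = 1) with `π(ι k) v ↦ (τ k)⁻¹ • π(ι k) v`.
-/
import Literature.NumberTheory.Automorphic.HilbertRepSpectrum      -- ★ `ContRepresentation.IsUnitary`, `IsStronglyContinuous`, `ClosedSubrep`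
import Mathlib.MeasureTheory.Integral.Bochner.ContinuousLinearMap
import Mathlib.MeasureTheory.Group.Integral
import Mathlib.Analysis.Convex.Integral
import Mathlib.Analysis.InnerProductSpace.Projection.Basic
import Mathlib.MeasureTheory.Function.L2Space
import Mathlib.LinearAlgebra.Eigenspace.Basic
import HarnessLib

/-!
# h413 ∕ Track B «K2-LIT», AMENDMENT #3 C.1, C7_τ FILE 1 — helper `K2E1KTypeAverageProjectionU`: THE `τ`-TWISTED `K`-AVERAGE `v ↦ ∫_K τ(k)⁻¹ • π(ι k) v dk` OF A UNITARY
# REPRESENTATION IS A CONTRACTION ONTO THE `τ`-ISOTYPIC VECTORS `H^{τ} = {v : π(ι k) v = τ(k) v}`, IT IS THE ORTHOGONAL PROJECTION ONTO `H^{τ}`, IT PRESERVES CLOSED INVARIANT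
# SUBSPACES, HENCE `E ∩ H^{τ} = closure span {∫_K τ(k)⁻¹ • π(ι k) s dk : s ∈ S}` WHENEVER `E = closure span S`

Cell `pub/hodgecm-mathlib`, crux h413 = `stmt-HodgeConjecture-24833`, route of record `HCCMUnconditional`; dealer K2E1-plan (g7) (265), AMENDMENT #3 rung C.1 (the `τ`-generic C7).
THEOREMS ONLY (no `def`, no `instance`, no notation, no named-fact hypothesis, no `sorry`); lane `--supports stmt-HodgeConjecture-24833 --as helper` (count-neutral).  Closes no socket.
ABSTRACT and GROUP-FREE, the τ = 1 file ★ `K2E1KAverageProjectionU` VERBATIM with the twist: `π` any unitary `ContRepresentation` of a group `G` on a complex Hilbert space `H`; `K` any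
topological group with a left-invariant PROBABILITY measure `μK` and a homomorphism `ι : K →* G` along which `π` is strongly continuous; `τ : K →* ℂ` a continuous UNITARY character
(`‖τ k‖ = 1`).  The twisted average is written as the Bochner integral `∫ k, (τ k)⁻¹ • π (ι k) v ∂μK` throughout (no definition is introduced); the `τ`-isotypic subspace is written in the
D-road currency `⨅ k, Module.End.eigenspace (π (ι k)) (τ k)` (★ `levelFinite_of_atoms`), membership `↔ ∀ k, π (ι k) v = τ k • v` (§1).

THE MATHEMATICS ([DeitmarEchterhoff2014, Lemma 1.6.3, Prop. 6.2.1, Lemma 7.2.6]; [Knapp1986, VIII §3]; [BorelJacquet1979, §4.6]; [MoeglinWaldspurger1995, II.1.2–II.1.4]).  `P_τ v :=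
∫_K τ(k)⁻¹ π(ι k) v dk`: a `τ`-vector is its own average (§2); `‖P_τ v‖ ≤ ‖v‖` (unitarity, `|τ| = 1`); `π(ι k₀) P_τ v = ∫ τ(k)⁻¹ π(ι(k₀k)) v = τ(k₀) ∫ τ(k₀k)⁻¹ π(ι(k₀k)) v = τ(k₀) P_τ v`
(left invariance of `μK`), so `P_τ v ∈ H^{τ}`; `P_τ` preserves closed invariant subspaces (`Convex.integral_mem`); for a `τ`-vector `w`, `⟪w, π(ι k) v⟫ = τ(k)⟪w, v⟫` (unitarity), so
`⟪w, P_τ v⟫ = ⟪w, v⟫` and `P_τ` IS THE ORTHOGONAL PROJECTION onto the closed subspace `H^{τ}` (§4); and `E ∩ H^{τ} = closure span (P_τ S)` for `E` closed `π`-stable, `S ⊆ E ⊆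
closure span S` (§3) — the `τ`-generic C7 (a): `E^{τ} = closure span {P_τ [θ_Φ]}`.
* §1 `mem_iInf_eigenspace_iff`, `isClosed_iInf_eigenspace`.
* §2 `tauAverage_eq_self_of_forall_apply_eq`, `norm_tauAverage_le`, `tauAverage_smul`, `integrable_tauApply`, `tauAverage_mem`, `tauAverage_add`, `exists_clm_tauAverage`,
  **`apply_tauAverage_eq`**, `tauAverage_mem_iInf_eigenspace`.
* §3 **`inf_iInf_eigenspace_eq_topologicalClosure_span_image_tauAverage`**, `mem_topologicalClosure_span_image_tauAverage`, `tauAverage_mem_and_forall_apply_eq`.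
* §4 `inner_apply_eq_mul_inner_of_forall`, **`starProjection_iInf_eigenspace_eq_tauAverage`** (the twisted average is the orthogonal projection onto `H^{τ}`).
HONEST LABEL: HC_CM is proved only modulo the 7 printed citations (2 remaining named inputs: hLiu418 = `stmt-HodgeConjecture-24832`, h413 = `stmt-HodgeConjecture-24833`) until rung 0
closes; this file asserts no named fact and closes no socket.

## References
* [DeitmarEchterhoff2014] A. Deitmar, S. Echterhoff, *Principles of Harmonic Analysis* (2nd ed., 2014), Lemma 1.6.3, Prop. 6.2.1, Lemma 7.2.6.
* [Knapp1986] A. W. Knapp, *Representation Theory of Semisimple Groups* (1986), VIII §3.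
* [BorelJacquet1979] A. Borel, H. Jacquet, *Automorphic forms and automorphic representations*, PSPM 33.1 (1979), §4.6.
* [MoeglinWaldspurger1995] C. Mœglin, J.-L. Waldspurger, *Spectral Decomposition and Eisenstein Series* (1995), II.1.2–II.1.4.
-/

set_option autoImplicit false
-- the mandated namespace repeats `HodgeConjecture.HodgeConjecture`, as in every `Theorems/*.lean` of this sub-problem
set_option linter.dupNamespace false

noncomputable section

open MeasureTheory Set Filter Topology
open scoped InnerProductSpace ComplexConjugate

namespace Summit.HodgeConjecture.HodgeConjecture.Cruxes.H413.K2E1KTypeAverageProjectionU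

variable {G : Type*} [Group G] {H : Type*} [NormedAddCommGroup H] [InnerProductSpace ℂ H] [CompleteSpace H] {π : ContRepresentation ℂ G H} {K : Type*} [Group K]
  (ι : K →* G) (τ : K →* ℂ)

/-! ## §1 The `τ`-isotypic subspace `H^{τ} = ⨅_k ker(π(ι k) − τ k)` -/

omit [CompleteSpace H] in
/-- Membership in the `τ`-isotypic subspace (D-road currency): `v ∈ ⨅_k eigenspace(π(ι k), τ k) ↔ ∀ k, π(ι k) v = τ k • v`. [cite: Knapp1986, VIII §3] -/
theorem mem_iInf_eigenspace_iff {v : H} : v ∈ (⨅ k, Module.End.eigenspace ((π (ι k) : H →L[ℂ] H) : H →ₗ[ℂ] H) (τ k)) ↔ ∀ k, π (ι k) v = τ k • v := by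
  simp only [Submodule.mem_iInf, Module.End.mem_eigenspace_iff, ContinuousLinearMap.coe_coe]

omit [CompleteSpace H] in
/-- The `τ`-isotypic subspace is closed (an intersection of equalisers of continuous maps). [folklore] -/
theorem isClosed_iInf_eigenspace : IsClosed ((⨅ k, Module.End.eigenspace ((π (ι k) : H →L[ℂ] H) : H →ₗ[ℂ] H) (τ k) : Submodule ℂ H) : Set H) := by
  have h : ((⨅ k, Module.End.eigenspace ((π (ι k) : H →L[ℂ] H) : H →ₗ[ℂ] H) (τ k) : Submodule ℂ H) : Set H) = ⋂ k : K, {v : H | π (ι k) v = τ k • v} := by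
    ext v
    simp only [SetLike.mem_coe, mem_iInf_eigenspace_iff, mem_iInter, mem_setOf_eq]
  rw [h]
  exact isClosed_iInter fun k => isClosed_eq (π (ι k)).continuous (continuous_const.smul continuous_id)

omit [CompleteSpace H] in
/-- `‖τ k‖ = 1` forces `τ k ≠ 0`. [folklore] -/
theorem ne_zero_of_norm_eq_one (hτ : ∀ k, ‖τ k‖ = 1) (k : K) : τ k ≠ 0 :=
  norm_ne_zero_iff.1 (by rw [hτ k]; exact one_ne_zero)

/-- **`⟪w, π(ι k) v⟫ = τ k · ⟪w, v⟫` FOR A `τ`-VECTOR `w`** (`π` unitary, `|τ k| = 1`): `⟪w, v⟫ = ⟪π(ι k) w, π(ι k) v⟫ = conj(τ k)·⟪w, π(ι k) v⟫` and `conj(τ k)·τ k = 1`.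
[cite: Knapp1986, VIII §3] -/
theorem inner_apply_eq_mul_inner_of_forall (hu : π.IsUnitary) (hτ : ∀ k, ‖τ k‖ = 1) {w : H} (hw : ∀ k, π (ι k) w = τ k • w) (v : H) (k : K) :
    ⟪w, π (ι k) v⟫_ℂ = τ k * ⟪w, v⟫_ℂ := by
  have h1 : ⟪w, v⟫_ℂ = conj (τ k) * ⟪w, π (ι k) v⟫_ℂ := by rw [← hu.inner_map_map (ι k) w v, hw k, inner_smul_left]
  have h2 : conj (τ k) * τ k = 1 := by rw [← Complex.normSq_eq_conj_mul_self, Complex.normSq_eq_norm_sq, hτ k, one_pow, Complex.ofReal_one]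
  calc ⟪w, π (ι k) v⟫_ℂ = (conj (τ k) * τ k) * ⟪w, π (ι k) v⟫_ℂ := by rw [h2, one_mul]
    _ = τ k * ⟪w, v⟫_ℂ := by rw [h1]; ring

/-! ## §2 The twisted average `∫_K τ(k)⁻¹ • π(ι k) v dk`: `τ`-vectors, contraction, integrability, membership, linearity, equivariance -/

section Probability

variable [MeasurableSpace K] (μK : Measure K) [IsProbabilityMeasure μK]

/-- **A `τ`-VECTOR IS ITS OWN TWISTED AVERAGE**: `∫_K τ(k)⁻¹ • π(ι k) v dk = v` when `π(ι k) v = τ k • v` for all `k` (`τ k ≠ 0`, `μK` a probability measure).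
[cite: DeitmarEchterhoff2014, Lemma 7.2.6] -/
theorem tauAverage_eq_self_of_forall_apply_eq (hτ0 : ∀ k, τ k ≠ 0) {v : H} (hv : ∀ k, π (ι k) v = τ k • v) : ∫ k, (τ k)⁻¹ • π (ι k) v ∂μK = v := by
  have h : (fun k => (τ k)⁻¹ • π (ι k) v) = fun _ => v := funext fun k => by rw [hv k, smul_smul, inv_mul_cancel₀ (hτ0 k), one_smul]
  rw [h, integral_const, probReal_univ, one_smul]

/-- **THE TWISTED AVERAGE IS A CONTRACTION**: `‖∫_K τ(k)⁻¹ • π(ι k) v dk‖ ≤ ‖v‖` (`π` unitary, `|τ| = 1`). [cite: DeitmarEchterhoff2014, Prop. 6.2.1] -/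
theorem norm_tauAverage_le (hu : π.IsUnitary) (hτ : ∀ k, ‖τ k‖ = 1) (v : H) : ‖∫ k, (τ k)⁻¹ • π (ι k) v ∂μK‖ ≤ ‖v‖ :=
  calc ‖∫ k, (τ k)⁻¹ • π (ι k) v ∂μK‖ ≤ ∫ _, ‖v‖ ∂μK := norm_integral_le_of_norm_le (integrable_const ‖v‖)
        (Eventually.of_forall fun k => by rw [norm_smul, norm_inv, hτ k, inv_one, one_mul]; exact (hu.norm_map (ι k) v).le)
    _ = ‖v‖ := by rw [integral_const, probReal_univ, one_smul]

omit [CompleteSpace H] [IsProbabilityMeasure μK] in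
/-- Homogeneity of the twisted average. [folklore] -/
theorem tauAverage_smul (c : ℂ) (v : H) : ∫ k, (τ k)⁻¹ • π (ι k) (c • v) ∂μK = c • ∫ k, (τ k)⁻¹ • π (ι k) v ∂μK := by
  have h : (fun k => (τ k)⁻¹ • π (ι k) (c • v)) = fun k => c • ((τ k)⁻¹ • π (ι k) v) := funext fun k => by rw [map_smul, smul_comm]
  rw [h]
  exact integral_smul c _

variable [TopologicalSpace K] [BorelSpace K] [SecondCountableTopology K]

/-- The twisted orbit `k ↦ τ(k)⁻¹ • π(ι k) v` is Bochner integrable on the probability space `(K, μK)` (continuous, of constant norm `‖v‖`). [cite: DeitmarEchterhoff2014, Prop. 6.2.1] -/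
theorem integrable_tauApply (hu : π.IsUnitary) (hc : (π.restrict ι).IsStronglyContinuous) (hτ : ∀ k, ‖τ k‖ = 1) (hτc : Continuous τ) (v : H) :
    Integrable (fun k => (τ k)⁻¹ • π (ι k) v) μK :=
  (integrable_const ‖v‖).mono' ((hτc.inv₀ (ne_zero_of_norm_eq_one τ hτ)).smul (hc v)).aestronglyMeasurable
    (Eventually.of_forall fun k => by rw [norm_smul, norm_inv, hτ k, inv_one, one_mul]; exact (hu.norm_map (ι k) v).le)

/-- **THE TWISTED AVERAGE STAYS IN EVERY CLOSED INVARIANT SUBSPACE** (a closed convex set containing the integrand a.e., probability measure: Mathlib `Convex.integral_mem`).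
[cite: DeitmarEchterhoff2014, §9.2] -/
theorem tauAverage_mem (hu : π.IsUnitary) (hc : (π.restrict ι).IsStronglyContinuous) (hτ : ∀ k, ‖τ k‖ = 1) (hτc : Continuous τ) (W : ContRepresentation.ClosedSubrep π)
    {v : H} (hv : v ∈ W) : (∫ k, (τ k)⁻¹ • π (ι k) v ∂μK) ∈ W :=
  (W.toSubmodule.restrictScalars ℝ).convex.integral_mem W.isClosed (Eventually.of_forall fun k => W.toSubmodule.smul_mem _ (W.apply_mem (ι k) hv))
    (integrable_tauApply ι τ μK hu hc hτ hτc v)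

/-- Additivity of the twisted average. [folklore] -/
theorem tauAverage_add (hu : π.IsUnitary) (hc : (π.restrict ι).IsStronglyContinuous) (hτ : ∀ k, ‖τ k‖ = 1) (hτc : Continuous τ) (v w : H) :
    ∫ k, (τ k)⁻¹ • π (ι k) (v + w) ∂μK = (∫ k, (τ k)⁻¹ • π (ι k) v ∂μK) + ∫ k, (τ k)⁻¹ • π (ι k) w ∂μK := by
  simp only [map_add, smul_add]
  exact integral_add (integrable_tauApply ι τ μK hu hc hτ hτc v) (integrable_tauApply ι τ μK hu hc hτ hτc w)

/-- **THE TWISTED AVERAGE AS A BOUNDED OPERATOR** `P : H →L[ℂ] H`, `P v = ∫_K τ(k)⁻¹ • π(ι k) v dk`, `‖P‖ ≤ 1` (no definition is introduced: an existential).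
[cite: DeitmarEchterhoff2014, Prop. 6.2.1] -/
theorem exists_clm_tauAverage (hu : π.IsUnitary) (hc : (π.restrict ι).IsStronglyContinuous) (hτ : ∀ k, ‖τ k‖ = 1) (hτc : Continuous τ) :
    ∃ P : H →L[ℂ] H, ∀ v, P v = ∫ k, (τ k)⁻¹ • π (ι k) v ∂μK :=
  ⟨LinearMap.mkContinuous { toFun := fun v => ∫ k, (τ k)⁻¹ • π (ι k) v ∂μK, map_add' := tauAverage_add ι τ μK hu hc hτ hτc, map_smul' := tauAverage_smul ι τ μK } 1
      fun v => by rw [one_mul]; exact norm_tauAverage_le ι τ μK hu hτ v,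
    fun _ => rfl⟩

variable [IsTopologicalGroup K] [μK.IsMulLeftInvariant]

/-- **THE TWISTED AVERAGE IS A `τ`-VECTOR**: `π(ι k₀) ∫_K τ(k)⁻¹ • π(ι k) v dk = ∫_K τ(k)⁻¹ • π(ι (k₀k)) v dk = τ(k₀) • ∫_K τ(k₀k)⁻¹ • π(ι (k₀k)) v dk = τ(k₀) • ∫_K τ(k)⁻¹ • π(ι k) v dk`
(the operator commutes with the Bochner integral; `τ` is multiplicative; `μK` is left-invariant). [cite: DeitmarEchterhoff2014, Lemma 7.2.6] [cite: Knapp1986, VIII §3] -/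
theorem apply_tauAverage_eq (hu : π.IsUnitary) (hc : (π.restrict ι).IsStronglyContinuous) (hτ : ∀ k, ‖τ k‖ = 1) (hτc : Continuous τ) (v : H) (k₀ : K) :
    π (ι k₀) (∫ k, (τ k)⁻¹ • π (ι k) v ∂μK) = τ k₀ • ∫ k, (τ k)⁻¹ • π (ι k) v ∂μK := by
  rw [← (π (ι k₀)).integral_comp_comm (integrable_tauApply ι τ μK hu hc hτ hτc v)]
  have h0 : τ k₀ ≠ 0 := ne_zero_of_norm_eq_one τ hτ k₀
  have h : (fun k => π (ι k₀) ((τ k)⁻¹ • π (ι k) v)) = fun k => τ k₀ • ((τ (k₀ * k))⁻¹ • π (ι (k₀ * k)) v) := funext fun k => by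
    rw [map_smul, map_mul, map_mul, map_mul, mul_inv, smul_smul, ← mul_assoc, mul_inv_cancel₀ h0, one_mul]
    rfl
  rw [h, integral_smul]
  congr 1
  exact integral_mul_left_eq_self (fun k => (τ k)⁻¹ • π (ι k) v) k₀

/-- The twisted average lies in the `τ`-isotypic subspace `⨅_k eigenspace(π(ι k), τ k)`. [cite: DeitmarEchterhoff2014, Lemma 7.2.6] -/
theorem tauAverage_mem_iInf_eigenspace (hu : π.IsUnitary) (hc : (π.restrict ι).IsStronglyContinuous) (hτ : ∀ k, ‖τ k‖ = 1) (hτc : Continuous τ) (v : H) :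
    (∫ k, (τ k)⁻¹ • π (ι k) v ∂μK) ∈ (⨅ k, Module.End.eigenspace ((π (ι k) : H →L[ℂ] H) : H →ₗ[ℂ] H) (τ k)) :=
  (mem_iInf_eigenspace_iff ι τ).2 fun k₀ => apply_tauAverage_eq ι τ μK hu hc hτ hτc v k₀

/-! ## §3 `E ∩ H^{τ}` is the closed span of the twisted averages of a spanning set of `E` -/

/-- **`E ∩ H^{τ} = closure span {∫_K τ(k)⁻¹ • π(ι k) s dk : s ∈ S}`** for a closed `π`-stable `E` and any `S ⊆ E` with `E ≤ closure (span S)`: `⊇` — each twisted average lies in `E`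
(`tauAverage_mem`) and in `H^{τ}` (`tauAverage_mem_iInf_eigenspace`), both closed; `⊆` — a `τ`-vector `v ∈ E` is its own twisted average, the average is a bounded operator `P`, and
`P (closure (span S)) ⊆ closure (P (span S)) ⊆ closure (span (P '' S))`. [cite: DeitmarEchterhoff2014, Lemma 7.2.6] [cite: MoeglinWaldspurger1995, II.1.2] -/
theorem inf_iInf_eigenspace_eq_topologicalClosure_span_image_tauAverage (hu : π.IsUnitary) (hc : (π.restrict ι).IsStronglyContinuous) (hτ : ∀ k, ‖τ k‖ = 1) (hτc : Continuous τ)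
    (E : ContRepresentation.ClosedSubrep π) {S : Set H} (hSE : S ⊆ E) (hES : E.toSubmodule ≤ (Submodule.span ℂ S).topologicalClosure) :
    E.toSubmodule ⊓ (⨅ k, Module.End.eigenspace ((π (ι k) : H →L[ℂ] H) : H →ₗ[ℂ] H) (τ k)) =
      (Submodule.span ℂ ((fun s => ∫ k, (τ k)⁻¹ • π (ι k) s ∂μK) '' S)).topologicalClosure := by
  obtain ⟨P, hP⟩ := exists_clm_tauAverage ι τ μK hu hc hτ hτc
  have hPS : (fun s => ∫ k, (τ k)⁻¹ • π (ι k) s ∂μK) '' S = P '' S := image_congr fun s _ => (hP s).symm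
  refine le_antisymm ?_ ?_
  · rintro v ⟨hvE, hvK⟩
    have hv : v = P v := by
      rw [hP, tauAverage_eq_self_of_forall_apply_eq ι τ μK (ne_zero_of_norm_eq_one τ hτ) fun k => (mem_iInf_eigenspace_iff ι τ).1 hvK k]
    have hvc : v ∈ closure (Submodule.span ℂ S : Set H) := by rw [← Submodule.topologicalClosure_coe]; exact hES hvE
    have h1 : P v ∈ closure (P '' (Submodule.span ℂ S : Set H)) := image_closure_subset_closure_image P.continuous ⟨v, hvc, rfl⟩
    have hle : Submodule.span ℂ S ≤ (Submodule.span ℂ (P '' S)).comap (P : H →ₗ[ℂ] H) := Submodule.span_le.2 fun s hs => Submodule.subset_span ⟨s, hs, rfl⟩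
    have h2 : P '' (Submodule.span ℂ S : Set H) ⊆ (Submodule.span ℂ (P '' S) : Set H) := by
      rintro _ ⟨w, hw, rfl⟩
      exact hle hw
    rw [hv, hPS]
    show P v ∈ ((Submodule.span ℂ (P '' S)).topologicalClosure : Set H)
    rw [Submodule.topologicalClosure_coe]
    exact closure_mono h2 h1
  · refine Submodule.topologicalClosure_minimal _ (Submodule.span_le.2 ?_) (E.isClosed.inter (isClosed_iInf_eigenspace ι τ))
    rintro _ ⟨s, hs, rfl⟩
    exact ⟨tauAverage_mem ι τ μK hu hc hτ hτc E (hSE hs), tauAverage_mem_iInf_eigenspace ι τ μK hu hc hτ hτc s⟩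

/-- **MEMBERSHIP FORM** (the `∀ k, R(ι k) v = τ k • v` currency): a `τ`-vector `v ∈ E` lies in the closed span of the twisted averages of `S`. [cite: DeitmarEchterhoff2014, Lemma 7.2.6] -/
theorem mem_topologicalClosure_span_image_tauAverage (hu : π.IsUnitary) (hc : (π.restrict ι).IsStronglyContinuous) (hτ : ∀ k, ‖τ k‖ = 1) (hτc : Continuous τ)
    (E : ContRepresentation.ClosedSubrep π) {S : Set H} (hSE : S ⊆ E) (hES : E.toSubmodule ≤ (Submodule.span ℂ S).topologicalClosure) {v : H} (hv : v ∈ E)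
    (hfix : ∀ k, π (ι k) v = τ k • v) :
    v ∈ (Submodule.span ℂ ((fun s => ∫ k, (τ k)⁻¹ • π (ι k) s ∂μK) '' S)).topologicalClosure := by
  rw [← inf_iInf_eigenspace_eq_topologicalClosure_span_image_tauAverage ι τ μK hu hc hτ hτc E hSE hES]
  exact ⟨hv, (mem_iInf_eigenspace_iff ι τ).2 hfix⟩

/-- **CONVERSELY** each twisted average `∫_K τ(k)⁻¹ • π(ι k) s dk`, `s ∈ E`, is a `τ`-vector of `E`. [cite: DeitmarEchterhoff2014, Lemma 7.2.6] -/
theorem tauAverage_mem_and_forall_apply_eq (hu : π.IsUnitary) (hc : (π.restrict ι).IsStronglyContinuous) (hτ : ∀ k, ‖τ k‖ = 1) (hτc : Continuous τ)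
    (E : ContRepresentation.ClosedSubrep π) {s : H} (hs : s ∈ E) :
    (∫ k, (τ k)⁻¹ • π (ι k) s ∂μK) ∈ E ∧ ∀ k₀, π (ι k₀) (∫ k, (τ k)⁻¹ • π (ι k) s ∂μK) = τ k₀ • ∫ k, (τ k)⁻¹ • π (ι k) s ∂μK :=
  ⟨tauAverage_mem ι τ μK hu hc hτ hτc E hs, apply_tauAverage_eq ι τ μK hu hc hτ hτc s⟩

/-! ## §4 The twisted average is the ORTHOGONAL PROJECTION onto `H^{τ}` -/

/-- **THE TWISTED AVERAGE IS THE ORTHOGONAL PROJECTION ONTO `H^{τ}`**: for every `v`, `P_{H^{τ}} v = ∫_K τ(k)⁻¹ • π(ι k) v dk` — the average is a `τ`-vector (§2) and `v − P_τ v ⊥ H^{τ}`: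
for a `τ`-vector `w`, `⟪w, P_τ v⟫ = ∫ τ(k)⁻¹·⟪w, π(ι k) v⟫ = ∫ ⟪w, v⟫ = ⟪w, v⟫` (§4 `inner_apply_eq_mul_inner_of_forall`, `integral_inner`).  (`H^{τ}` is closed, §1, hence has the
orthogonal projection in the complete `H`; the instance is taken as a hypothesis so that the statement elaborates for any `π`.) [cite: DeitmarEchterhoff2014, Lemma 7.2.6] [cite: Knapp1986, VIII §3] -/
theorem starProjection_iInf_eigenspace_eq_tauAverage (hu : π.IsUnitary) (hc : (π.restrict ι).IsStronglyContinuous) (hτ : ∀ k, ‖τ k‖ = 1) (hτc : Continuous τ)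
    [(⨅ k, Module.End.eigenspace ((π (ι k) : H →L[ℂ] H) : H →ₗ[ℂ] H) (τ k)).HasOrthogonalProjection] (v : H) :
    (⨅ k, Module.End.eigenspace ((π (ι k) : H →L[ℂ] H) : H →ₗ[ℂ] H) (τ k)).starProjection v = ∫ k, (τ k)⁻¹ • π (ι k) v ∂μK := by
  refine Submodule.eq_starProjection_of_mem_of_inner_eq_zero (tauAverage_mem_iInf_eigenspace ι τ μK hu hc hτ hτc v) fun w hw => ?_
  have hw' : ∀ k, π (ι k) w = τ k • w := (mem_iInf_eigenspace_iff ι τ).1 hw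
  rw [← inner_conj_symm, inner_sub_right, ← integral_inner (integrable_tauApply ι τ μK hu hc hτ hτc v) w]
  have h : (fun k => ⟪w, (τ k)⁻¹ • π (ι k) v⟫_ℂ) = fun _ => ⟪w, v⟫_ℂ := funext fun k => by
    rw [inner_smul_right, inner_apply_eq_mul_inner_of_forall ι τ hu hτ hw' v k, ← mul_assoc, inv_mul_cancel₀ (ne_zero_of_norm_eq_one τ hτ k), one_mul]
  rw [h, integral_const, probReal_univ, one_smul, sub_self, map_zero]

end Probability

end Summit.HodgeConjecture.HodgeConjecture.Cruxes.H413.K2E1KTypeAverageProjectionU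

end
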